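/-
COR-CM (cell pub-hodgecm2, stage 2 of the Hodge ladder) — count-neutral KERNEL COMBINATORICS «the named composite cyclotomic fields, exact, II»
(seat prover-pub-hodgecm2-b23-g39-0, binder prover b23, gen 39; claim ABELIAN-DATUM D5, HOME/INBOX.md l.9517; blanket `CorCM/FaceCyclotomic*`).
Theorems only: D4 `CorCM/FaceAbelianExact.lean` (`isLeast_card_faces_hgen_cyclotomic_of_unitTable_even`) with gen 37's orbit numerals
(`Census/EvenSliceOrbitCount{,B}.lean`) BY NAME; unit tables by `decide +kernel`; no geometry, no named fact, nothing asserted; `Interfaces.lean`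
(C1), every E term, B01 and `Transposition/*` are untouched.
HONEST FRAMING (COORDINATOR RULING — HODGE FRAMING CORRECTION, 2026-08-21T11:55:35Z): `HC_CM` is NOT proved, here or anywhere in the
tree; this file counts faces and produces no period.
T5: n/a-class — no HC-level conclusion; checker: self (prover-pub-hodgecm2-b23-g39-0), 2026-08-22.
-/
import Summits.HodgeConjecture.CorCM.FaceAbelianExact
import Summits.HodgeConjecture.CorCM.Census.EvenSliceOrbitCount
import Summits.HodgeConjecture.CorCM.Census.EvenSliceOrbitCountB
import HarnessLib

/-!
# The named composite cyclotomic CM fields, exact, II: `ℚ(ζ₃₃), ℚ(ζ₄₄), ℚ(ζ₃₅), ℚ(ζ₃₉), ℚ(ζ₄₅), ℚ(ζ₄₀), ℚ(ζ₄₈), ℚ(ζ₆₀)`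

For each field `K` (ANY CM field with `[IsCyclotomicExtension {N} ℚ K]`, no further hypothesis) and every base embedding `σ₀`, the least
number of rank-four faces of `K` whose Weil characters at all base embeddings generate those of every face of `K` (the INT2-GEN binder
`hgen(𝒮, σ₀)`) is EXACTLY `#OrbitsA A − 1 = β(K) − 2`:

| `N` | `[K:ℚ]` | `A ≅ Gal(K⁺/ℚ)` | `#OrbitsA A` | `β(K)` | least #faces |
|---|---|---|---|---|---|
| 33 | 20 | `ZMod 10` | 55 | 56 | **54** |
| 44 | 20 | `ZMod 10` | 55 | 56 | **54** |
| 35 | 24 | `ZMod 12` | 179 | 180 | **178** |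
| 39 | 24 | `ZMod 12` | 179 | 180 | **178** |
| 45 | 24 | `ZMod 12` | 179 | 180 | **178** |
| 40 | 16 | `ZMod 2 × ZMod 4` | 23 | 24 | **22** |
| 48 | 16 | `ZMod 2 × ZMod 4` | 23 | 24 | **22** |
| 60 | 16 | `ZMod 2 × ZMod 4` | 23 | 24 | **22** |

(existence: gen 37's canonical squares transported datum-free, D2/D3; floor: seat b09's `FaceCoinvariantComplement` XIV through D4's
`card_block_eq_card_orbitsA_add_one` and `exists_cpl_of_datum`.)  Companion: `CorCM/FaceCyclotomicCompositeExact.lean` (`N = 15, 16, 20, 24, 21, 28, 32, 36`).  `HC_CM` is NOT proved; no period is produced.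

References: [cite: Washington1997, Thm. 2.5]; [cite: Pohlmann1968, Thm. 1]; [cite: Milne1999LefschetzClasses, Thm. 3.2, Prop. 2.1];
[cite: Shimura1998, §8.1 (p. 62)].
-/

noncomputable section

open NumberField NumberField.ComplexEmbedding

namespace Summit.HodgeConjecture.CorCM.FaceAbelian

open Literature.AlgebraicGeometry.Motives (CMType)
open Summit.HodgeConjecture.CorCM.Prior.AllgGroup.RfwfAllgGroup
open Summit.HodgeConjecture.CorCM.Census.OddDegreeParityLaw (OrbitsA)
open Summit.HodgeConjecture.CorCM.Census.EvenSliceOrbitCount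

/-- **`ℚ(ζ₃₃)`: EXACTLY `54` generating faces, none fewer** (`A ≅ ℤ/10`, `55` orbits, `β = 56`), for every base
embedding — no datum hypothesis. [cite: Pohlmann1968, Thm. 1] [cite: Milne1999LefschetzClasses, Thm. 3.2] [cite: Washington1997, Thm. 2.5] -/
theorem isLeast_card_faces_hgen_cyclotomic_thirtyThree (K : CMField) [IsCyclotomicExtension {33} ℚ (K : Type)]
    (σ₀ : (K : Type) →+* ℂ) :
    IsLeast {m : ℕ | ∃ 𝒮 : Finset (Face K), 𝒮.card = m ∧
      ∀ f : Face K, lefChar f.corner (fun _ => ({σ₀} : Finset ((K : Type) →+* ℂ))) ∈ AddSubgroup.closure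
        {a : Asym K | ∃ g ∈ (𝒮 : Set (Face K)), ∃ σ : (K : Type) →+* ℂ, a = lefChar g.corner (fun _ => ({σ} : Finset ((K : Type) →+* ℂ)))}}
      54 := by
  have h := isLeast_card_faces_hgen_cyclotomic_of_unitTable_even (F := (K : Type)) (N := 33) (A := ZMod 10) (by decide +kernel)
    (fun u : (ZMod 33)ˣ =>
      if (u : ZMod 33).val = 1 ∨ (u : ZMod 33).val = 32 then (0 : ZMod 10) else
      if (u : ZMod 33).val = 5 ∨ (u : ZMod 33).val = 28 then (1 : ZMod 10) else
      if (u : ZMod 33).val = 8 ∨ (u : ZMod 33).val = 25 then (2 : ZMod 10) else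
      if (u : ZMod 33).val = 7 ∨ (u : ZMod 33).val = 26 then (3 : ZMod 10) else
      if (u : ZMod 33).val = 2 ∨ (u : ZMod 33).val = 31 then (4 : ZMod 10) else
      if (u : ZMod 33).val = 10 ∨ (u : ZMod 33).val = 23 then (5 : ZMod 10) else
      if (u : ZMod 33).val = 16 ∨ (u : ZMod 33).val = 17 then (6 : ZMod 10) else
      if (u : ZMod 33).val = 14 ∨ (u : ZMod 33).val = 19 then (7 : ZMod 10) else
      if (u : ZMod 33).val = 4 ∨ (u : ZMod 33).val = 29 then (8 : ZMod 10) else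
      (9 : ZMod 10))
    (by decide +kernel) (by decide +kernel) (by decide +kernel) (by decide +kernel) (by simp only [ZMod.card]; decide) (by simp only [ZMod.card]; norm_num) σ₀
  rwa [← Nat.card_eq_fintype_card, card_orbitsA_zmod_ten] at h

/-- **`ℚ(ζ₄₄)`: EXACTLY `54` generating faces, none fewer** (`A ≅ ℤ/10`, `55` orbits, `β = 56`), for every base
embedding — no datum hypothesis. [cite: Pohlmann1968, Thm. 1] [cite: Milne1999LefschetzClasses, Thm. 3.2] [cite: Washington1997, Thm. 2.5] -/
theorem isLeast_card_faces_hgen_cyclotomic_fortyFour (K : CMField) [IsCyclotomicExtension {44} ℚ (K : Type)]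
    (σ₀ : (K : Type) →+* ℂ) :
    IsLeast {m : ℕ | ∃ 𝒮 : Finset (Face K), 𝒮.card = m ∧
      ∀ f : Face K, lefChar f.corner (fun _ => ({σ₀} : Finset ((K : Type) →+* ℂ))) ∈ AddSubgroup.closure
        {a : Asym K | ∃ g ∈ (𝒮 : Set (Face K)), ∃ σ : (K : Type) →+* ℂ, a = lefChar g.corner (fun _ => ({σ} : Finset ((K : Type) →+* ℂ)))}}
      54 := by
  have h := isLeast_card_faces_hgen_cyclotomic_of_unitTable_even (F := (K : Type)) (N := 44) (A := ZMod 10) (by decide +kernel)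
    (fun u : (ZMod 44)ˣ =>
      if (u : ZMod 44).val = 1 ∨ (u : ZMod 44).val = 43 then (0 : ZMod 10) else
      if (u : ZMod 44).val = 3 ∨ (u : ZMod 44).val = 41 then (1 : ZMod 10) else
      if (u : ZMod 44).val = 9 ∨ (u : ZMod 44).val = 35 then (2 : ZMod 10) else
      if (u : ZMod 44).val = 17 ∨ (u : ZMod 44).val = 27 then (3 : ZMod 10) else
      if (u : ZMod 44).val = 7 ∨ (u : ZMod 44).val = 37 then (4 : ZMod 10) else
      if (u : ZMod 44).val = 21 ∨ (u : ZMod 44).val = 23 then (5 : ZMod 10) else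
      if (u : ZMod 44).val = 19 ∨ (u : ZMod 44).val = 25 then (6 : ZMod 10) else
      if (u : ZMod 44).val = 13 ∨ (u : ZMod 44).val = 31 then (7 : ZMod 10) else
      if (u : ZMod 44).val = 5 ∨ (u : ZMod 44).val = 39 then (8 : ZMod 10) else
      (9 : ZMod 10))
    (by decide +kernel) (by decide +kernel) (by decide +kernel) (by decide +kernel) (by simp only [ZMod.card]; decide) (by simp only [ZMod.card]; norm_num) σ₀
  rwa [← Nat.card_eq_fintype_card, card_orbitsA_zmod_ten] at h

/-- **`ℚ(ζ₃₅)`: EXACTLY `178` generating faces, none fewer** (`A ≅ ℤ/12`, `179` orbits, `β = 180`), for every base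
embedding — no datum hypothesis. [cite: Pohlmann1968, Thm. 1] [cite: Milne1999LefschetzClasses, Thm. 3.2] [cite: Washington1997, Thm. 2.5] -/
theorem isLeast_card_faces_hgen_cyclotomic_thirtyFive (K : CMField) [IsCyclotomicExtension {35} ℚ (K : Type)]
    (σ₀ : (K : Type) →+* ℂ) :
    IsLeast {m : ℕ | ∃ 𝒮 : Finset (Face K), 𝒮.card = m ∧
      ∀ f : Face K, lefChar f.corner (fun _ => ({σ₀} : Finset ((K : Type) →+* ℂ))) ∈ AddSubgroup.closure
        {a : Asym K | ∃ g ∈ (𝒮 : Set (Face K)), ∃ σ : (K : Type) →+* ℂ, a = lefChar g.corner (fun _ => ({σ} : Finset ((K : Type) →+* ℂ)))}}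
      178 := by
  have h := isLeast_card_faces_hgen_cyclotomic_of_unitTable_even (F := (K : Type)) (N := 35) (A := ZMod 12) (by decide +kernel)
    (fun u : (ZMod 35)ˣ =>
      if (u : ZMod 35).val = 1 ∨ (u : ZMod 35).val = 34 then (0 : ZMod 12) else
      if (u : ZMod 35).val = 2 ∨ (u : ZMod 35).val = 33 then (1 : ZMod 12) else
      if (u : ZMod 35).val = 4 ∨ (u : ZMod 35).val = 31 then (2 : ZMod 12) else
      if (u : ZMod 35).val = 8 ∨ (u : ZMod 35).val = 27 then (3 : ZMod 12) else
      if (u : ZMod 35).val = 16 ∨ (u : ZMod 35).val = 19 then (4 : ZMod 12) else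
      if (u : ZMod 35).val = 3 ∨ (u : ZMod 35).val = 32 then (5 : ZMod 12) else
      if (u : ZMod 35).val = 6 ∨ (u : ZMod 35).val = 29 then (6 : ZMod 12) else
      if (u : ZMod 35).val = 12 ∨ (u : ZMod 35).val = 23 then (7 : ZMod 12) else
      if (u : ZMod 35).val = 11 ∨ (u : ZMod 35).val = 24 then (8 : ZMod 12) else
      if (u : ZMod 35).val = 13 ∨ (u : ZMod 35).val = 22 then (9 : ZMod 12) else
      if (u : ZMod 35).val = 9 ∨ (u : ZMod 35).val = 26 then (10 : ZMod 12) else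
      (11 : ZMod 12))
    (by decide +kernel) (by decide +kernel) (by decide +kernel) (by decide +kernel) (by simp only [ZMod.card]; decide) (by simp only [ZMod.card]; norm_num) σ₀
  rwa [← Nat.card_eq_fintype_card, card_orbitsA_zmod_twelve] at h

/-- **`ℚ(ζ₃₉)`: EXACTLY `178` generating faces, none fewer** (`A ≅ ℤ/12`, `179` orbits, `β = 180`), for every base
embedding — no datum hypothesis. [cite: Pohlmann1968, Thm. 1] [cite: Milne1999LefschetzClasses, Thm. 3.2] [cite: Washington1997, Thm. 2.5] -/
theorem isLeast_card_faces_hgen_cyclotomic_thirtyNine (K : CMField) [IsCyclotomicExtension {39} ℚ (K : Type)]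
    (σ₀ : (K : Type) →+* ℂ) :
    IsLeast {m : ℕ | ∃ 𝒮 : Finset (Face K), 𝒮.card = m ∧
      ∀ f : Face K, lefChar f.corner (fun _ => ({σ₀} : Finset ((K : Type) →+* ℂ))) ∈ AddSubgroup.closure
        {a : Asym K | ∃ g ∈ (𝒮 : Set (Face K)), ∃ σ : (K : Type) →+* ℂ, a = lefChar g.corner (fun _ => ({σ} : Finset ((K : Type) →+* ℂ)))}}
      178 := by
  have h := isLeast_card_faces_hgen_cyclotomic_of_unitTable_even (F := (K : Type)) (N := 39) (A := ZMod 12) (by decide +kernel)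
    (fun u : (ZMod 39)ˣ =>
      if (u : ZMod 39).val = 1 ∨ (u : ZMod 39).val = 38 then (0 : ZMod 12) else
      if (u : ZMod 39).val = 2 ∨ (u : ZMod 39).val = 37 then (1 : ZMod 12) else
      if (u : ZMod 39).val = 4 ∨ (u : ZMod 39).val = 35 then (2 : ZMod 12) else
      if (u : ZMod 39).val = 8 ∨ (u : ZMod 39).val = 31 then (3 : ZMod 12) else
      if (u : ZMod 39).val = 16 ∨ (u : ZMod 39).val = 23 then (4 : ZMod 12) else
      if (u : ZMod 39).val = 7 ∨ (u : ZMod 39).val = 32 then (5 : ZMod 12) else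
      if (u : ZMod 39).val = 14 ∨ (u : ZMod 39).val = 25 then (6 : ZMod 12) else
      if (u : ZMod 39).val = 11 ∨ (u : ZMod 39).val = 28 then (7 : ZMod 12) else
      if (u : ZMod 39).val = 17 ∨ (u : ZMod 39).val = 22 then (8 : ZMod 12) else
      if (u : ZMod 39).val = 5 ∨ (u : ZMod 39).val = 34 then (9 : ZMod 12) else
      if (u : ZMod 39).val = 10 ∨ (u : ZMod 39).val = 29 then (10 : ZMod 12) else
      (11 : ZMod 12))
    (by decide +kernel) (by decide +kernel) (by decide +kernel) (by decide +kernel) (by simp only [ZMod.card]; decide) (by simp only [ZMod.card]; norm_num) σ₀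
  rwa [← Nat.card_eq_fintype_card, card_orbitsA_zmod_twelve] at h

/-- **`ℚ(ζ₄₅)`: EXACTLY `178` generating faces, none fewer** (`A ≅ ℤ/12`, `179` orbits, `β = 180`), for every base
embedding — no datum hypothesis. [cite: Pohlmann1968, Thm. 1] [cite: Milne1999LefschetzClasses, Thm. 3.2] [cite: Washington1997, Thm. 2.5] -/
theorem isLeast_card_faces_hgen_cyclotomic_fortyFive (K : CMField) [IsCyclotomicExtension {45} ℚ (K : Type)]
    (σ₀ : (K : Type) →+* ℂ) :
    IsLeast {m : ℕ | ∃ 𝒮 : Finset (Face K), 𝒮.card = m ∧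
      ∀ f : Face K, lefChar f.corner (fun _ => ({σ₀} : Finset ((K : Type) →+* ℂ))) ∈ AddSubgroup.closure
        {a : Asym K | ∃ g ∈ (𝒮 : Set (Face K)), ∃ σ : (K : Type) →+* ℂ, a = lefChar g.corner (fun _ => ({σ} : Finset ((K : Type) →+* ℂ)))}}
      178 := by
  have h := isLeast_card_faces_hgen_cyclotomic_of_unitTable_even (F := (K : Type)) (N := 45) (A := ZMod 12) (by decide +kernel)
    (fun u : (ZMod 45)ˣ =>
      if (u : ZMod 45).val = 1 ∨ (u : ZMod 45).val = 44 then (0 : ZMod 12) else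
      if (u : ZMod 45).val = 2 ∨ (u : ZMod 45).val = 43 then (1 : ZMod 12) else
      if (u : ZMod 45).val = 4 ∨ (u : ZMod 45).val = 41 then (2 : ZMod 12) else
      if (u : ZMod 45).val = 8 ∨ (u : ZMod 45).val = 37 then (3 : ZMod 12) else
      if (u : ZMod 45).val = 16 ∨ (u : ZMod 45).val = 29 then (4 : ZMod 12) else
      if (u : ZMod 45).val = 13 ∨ (u : ZMod 45).val = 32 then (5 : ZMod 12) else
      if (u : ZMod 45).val = 19 ∨ (u : ZMod 45).val = 26 then (6 : ZMod 12) else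
      if (u : ZMod 45).val = 7 ∨ (u : ZMod 45).val = 38 then (7 : ZMod 12) else
      if (u : ZMod 45).val = 14 ∨ (u : ZMod 45).val = 31 then (8 : ZMod 12) else
      if (u : ZMod 45).val = 17 ∨ (u : ZMod 45).val = 28 then (9 : ZMod 12) else
      if (u : ZMod 45).val = 11 ∨ (u : ZMod 45).val = 34 then (10 : ZMod 12) else
      (11 : ZMod 12))
    (by decide +kernel) (by decide +kernel) (by decide +kernel) (by decide +kernel) (by simp only [ZMod.card]; decide) (by simp only [ZMod.card]; norm_num) σ₀
  rwa [← Nat.card_eq_fintype_card, card_orbitsA_zmod_twelve] at h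

/-- **`ℚ(ζ₄₀)`: EXACTLY `22` generating faces, none fewer** (`A ≅ ℤ/2 × ℤ/4`, `23` orbits, `β = 24`), for every base
embedding — no datum hypothesis. [cite: Pohlmann1968, Thm. 1] [cite: Milne1999LefschetzClasses, Thm. 3.2] [cite: Washington1997, Thm. 2.5] -/
theorem isLeast_card_faces_hgen_cyclotomic_forty (K : CMField) [IsCyclotomicExtension {40} ℚ (K : Type)]
    (σ₀ : (K : Type) →+* ℂ) :
    IsLeast {m : ℕ | ∃ 𝒮 : Finset (Face K), 𝒮.card = m ∧
      ∀ f : Face K, lefChar f.corner (fun _ => ({σ₀} : Finset ((K : Type) →+* ℂ))) ∈ AddSubgroup.closure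
        {a : Asym K | ∃ g ∈ (𝒮 : Set (Face K)), ∃ σ : (K : Type) →+* ℂ, a = lefChar g.corner (fun _ => ({σ} : Finset ((K : Type) →+* ℂ)))}}
      22 := by
  have h := isLeast_card_faces_hgen_cyclotomic_of_unitTable_even (F := (K : Type)) (N := 40) (A := ZMod 2 × ZMod 4) (by decide +kernel)
    (fun u : (ZMod 40)ˣ =>
      if (u : ZMod 40).val = 1 ∨ (u : ZMod 40).val = 39 then ((0, 0) : ZMod 2 × ZMod 4) else
      if (u : ZMod 40).val = 3 ∨ (u : ZMod 40).val = 37 then ((0, 1) : ZMod 2 × ZMod 4) else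
      if (u : ZMod 40).val = 9 ∨ (u : ZMod 40).val = 31 then ((0, 2) : ZMod 2 × ZMod 4) else
      if (u : ZMod 40).val = 13 ∨ (u : ZMod 40).val = 27 then ((0, 3) : ZMod 2 × ZMod 4) else
      if (u : ZMod 40).val = 11 ∨ (u : ZMod 40).val = 29 then ((1, 0) : ZMod 2 × ZMod 4) else
      if (u : ZMod 40).val = 7 ∨ (u : ZMod 40).val = 33 then ((1, 1) : ZMod 2 × ZMod 4) else
      if (u : ZMod 40).val = 19 ∨ (u : ZMod 40).val = 21 then ((1, 2) : ZMod 2 × ZMod 4) else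
      ((1, 3) : ZMod 2 × ZMod 4))
    (by decide +kernel) (by decide +kernel) (by decide +kernel) (by decide +kernel) (by simp only [Fintype.card_prod, ZMod.card]; decide) (by simp only [Fintype.card_prod, ZMod.card]; norm_num) σ₀
  rwa [← Nat.card_eq_fintype_card, card_orbitsA_zmod_two_four] at h

/-- **`ℚ(ζ₄₈)`: EXACTLY `22` generating faces, none fewer** (`A ≅ ℤ/2 × ℤ/4`, `23` orbits, `β = 24`), for every base
embedding — no datum hypothesis. [cite: Pohlmann1968, Thm. 1] [cite: Milne1999LefschetzClasses, Thm. 3.2] [cite: Washington1997, Thm. 2.5] -/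
theorem isLeast_card_faces_hgen_cyclotomic_fortyEight (K : CMField) [IsCyclotomicExtension {48} ℚ (K : Type)]
    (σ₀ : (K : Type) →+* ℂ) :
    IsLeast {m : ℕ | ∃ 𝒮 : Finset (Face K), 𝒮.card = m ∧
      ∀ f : Face K, lefChar f.corner (fun _ => ({σ₀} : Finset ((K : Type) →+* ℂ))) ∈ AddSubgroup.closure
        {a : Asym K | ∃ g ∈ (𝒮 : Set (Face K)), ∃ σ : (K : Type) →+* ℂ, a = lefChar g.corner (fun _ => ({σ} : Finset ((K : Type) →+* ℂ)))}}
      22 := by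
  have h := isLeast_card_faces_hgen_cyclotomic_of_unitTable_even (F := (K : Type)) (N := 48) (A := ZMod 2 × ZMod 4) (by decide +kernel)
    (fun u : (ZMod 48)ˣ =>
      if (u : ZMod 48).val = 1 ∨ (u : ZMod 48).val = 47 then ((0, 0) : ZMod 2 × ZMod 4) else
      if (u : ZMod 48).val = 5 ∨ (u : ZMod 48).val = 43 then ((0, 1) : ZMod 2 × ZMod 4) else
      if (u : ZMod 48).val = 23 ∨ (u : ZMod 48).val = 25 then ((0, 2) : ZMod 2 × ZMod 4) else
      if (u : ZMod 48).val = 19 ∨ (u : ZMod 48).val = 29 then ((0, 3) : ZMod 2 × ZMod 4) else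
      if (u : ZMod 48).val = 7 ∨ (u : ZMod 48).val = 41 then ((1, 0) : ZMod 2 × ZMod 4) else
      if (u : ZMod 48).val = 13 ∨ (u : ZMod 48).val = 35 then ((1, 1) : ZMod 2 × ZMod 4) else
      if (u : ZMod 48).val = 17 ∨ (u : ZMod 48).val = 31 then ((1, 2) : ZMod 2 × ZMod 4) else
      ((1, 3) : ZMod 2 × ZMod 4))
    (by decide +kernel) (by decide +kernel) (by decide +kernel) (by decide +kernel) (by simp only [Fintype.card_prod, ZMod.card]; decide) (by simp only [Fintype.card_prod, ZMod.card]; norm_num) σ₀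
  rwa [← Nat.card_eq_fintype_card, card_orbitsA_zmod_two_four] at h

/-- **`ℚ(ζ₆₀)`: EXACTLY `22` generating faces, none fewer** (`A ≅ ℤ/2 × ℤ/4`, `23` orbits, `β = 24`), for every base
embedding — no datum hypothesis. [cite: Pohlmann1968, Thm. 1] [cite: Milne1999LefschetzClasses, Thm. 3.2] [cite: Washington1997, Thm. 2.5] -/
theorem isLeast_card_faces_hgen_cyclotomic_sixty (K : CMField) [IsCyclotomicExtension {60} ℚ (K : Type)]
    (σ₀ : (K : Type) →+* ℂ) :
    IsLeast {m : ℕ | ∃ 𝒮 : Finset (Face K), 𝒮.card = m ∧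
      ∀ f : Face K, lefChar f.corner (fun _ => ({σ₀} : Finset ((K : Type) →+* ℂ))) ∈ AddSubgroup.closure
        {a : Asym K | ∃ g ∈ (𝒮 : Set (Face K)), ∃ σ : (K : Type) →+* ℂ, a = lefChar g.corner (fun _ => ({σ} : Finset ((K : Type) →+* ℂ)))}}
      22 := by
  have h := isLeast_card_faces_hgen_cyclotomic_of_unitTable_even (F := (K : Type)) (N := 60) (A := ZMod 2 × ZMod 4) (by decide +kernel)
    (fun u : (ZMod 60)ˣ =>
      if (u : ZMod 60).val = 1 ∨ (u : ZMod 60).val = 59 then ((0, 0) : ZMod 2 × ZMod 4) else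
      if (u : ZMod 60).val = 7 ∨ (u : ZMod 60).val = 53 then ((0, 1) : ZMod 2 × ZMod 4) else
      if (u : ZMod 60).val = 11 ∨ (u : ZMod 60).val = 49 then ((0, 2) : ZMod 2 × ZMod 4) else
      if (u : ZMod 60).val = 17 ∨ (u : ZMod 60).val = 43 then ((0, 3) : ZMod 2 × ZMod 4) else
      if (u : ZMod 60).val = 19 ∨ (u : ZMod 60).val = 41 then ((1, 0) : ZMod 2 × ZMod 4) else
      if (u : ZMod 60).val = 13 ∨ (u : ZMod 60).val = 47 then ((1, 1) : ZMod 2 × ZMod 4) else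
      if (u : ZMod 60).val = 29 ∨ (u : ZMod 60).val = 31 then ((1, 2) : ZMod 2 × ZMod 4) else
      ((1, 3) : ZMod 2 × ZMod 4))
    (by decide +kernel) (by decide +kernel) (by decide +kernel) (by decide +kernel) (by simp only [Fintype.card_prod, ZMod.card]; decide) (by simp only [Fintype.card_prod, ZMod.card]; norm_num) σ₀
  rwa [← Nat.card_eq_fintype_card, card_orbitsA_zmod_two_four] at h

end Summit.HodgeConjecture.CorCM.FaceAbelian

end
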